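import Summits.QuantumFields.YangMills.Theorems.FluctuationComparisonRegPrIntLOrganTangentFibreWeightNormalisation
import HarnessLib

/-!
# Route `UnitScaleTilt` — crux `FluctuationComparisonRegPrIntL` (stmt-QuantumFields-20520, rung R3), PATH-B organ: SQUARE INTEGRABILITY ⟸ SQUARE STABILITY —
# the INT-CONCL integrabilities of `SpreadFibreLawH(J)` ((JV0-h)'s second half, and every `Integrable` conjunct of (JT-h)∕(L1ʲ-h)∕(L2ʲ-h)∕(JV1–4)) reduce to ONE geometric fact

Cell `ym3-torus` (rung R3 = continuum `SU(2)` Yang–Mills on T³ — NOT d = 4, NOT infinite volume, NOT a mass gap, NOT Clay).  LEAD-20520 width seat `ym-ust-20520-w3` g26;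
def-free, `--supports stmt-QuantumFields-20520 --as helper`, default heartbeats, `autoImplicit false`.

WHAT.  §1 (abstract, one fibre `(Z, τ)`): `integrable_mul_of_abs_le_on_support` — a measurable `g` bounded by `M` on the support of an integrable measurable weight `w` gives an
integrable product `g·w` (the product equals `(g·𝟙_{w ≠ 0})·w`, a bounded measurable factor times an integrable one); `integrable_mul_mul_of_abs_le_on_support` — the same for a
product of two such factors.  §2 (the organ's objects, over ✓`…FibreWeightNormalisation.wgt_normalised` and the reviewed letters `mwCut`∕`wNum`∕`wgt` of ✓p812742):
`abs_logRatio_le_of_plaq_le` — on the closed `c·θ_Ts`-plaquette window (`c < 1`) the pinned functional `h_Ts = log ρ_Ts − log ρ′_Ts` is bounded (continuous on the open window,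
compactness of the gauge-field space); ★★`integrable_logRatio_mul_wgt_of_squareStability` — SQUARE STABILITY at `(X, Xw)` («whenever `z` lies in the support of the law over
`Xw`, the transported field `Φ(X, z)` has all plaquettes within `c·θ_Ts`») ⟹ `Integrable (h_Ts∘Φ(X,·) · wgt_t(Xw,·))` and `Integrable ((h_Ts∘Φ(X,·))² · wgt_t(Xw,·))` for every real
`t` — i.e. the second half of `SpreadFibreLawHJ`'s (JV0-h) at `(t, X, Xw)`; the first half is ✓`wgt_normalised`.  The same two §1 lemmas serve every other `Integrable` conjunct of
the rows (products of at most two centred transported copies of `h_Ts` against one law), so the DISCHARGER's integrability debt is exactly SQUARE STABILITY — in print the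
Lipschitz dependence of the minimal lift on the coarse field ([Balaban1985Variational] Thm 1 p.279, (9)–(10)) read on `supp χ_{j,Ts}`; NOT proved here.

HONEST FRAMING: measure-theory bookkeeping ([folklore]); square stability is a HYPOTHESIS of the theorems below, not a result; nothing of Bałaban's analysis is asserted or
proved; `SpreadFibreLawH(J)` remain hypothesis rows; JVAR″, JEN″, LIN″, O1ᵘ-H v2.2, S1aᴴ, S3ᴴ, S2α′, S2β, 26243, the five registered stubs of
`Lines/semiclassical_s2beta.lean`, crux 20520 and `YM3TorusSU2` are NOT proved; rung R3 = SU(2) YM₃ on T³ at fixed lattice data — NOT d = 4, NOT infinite volume, NOT a mass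
gap, NOT Clay; the Yang–Mills mass gap is NOT proved.
-/

set_option autoImplicit false

noncomputable section

namespace Summit.QuantumFields.YangMills.Theorems.OrganTangentFibreWeightSquareIntegrability

open MeasureTheory Filter Topology
open scoped ENNReal NNReal
open Literature.MathematicalPhysics.QuantumFieldTheory.Balaban1983to89 T3ContinuumYM3Torus T3NestedUnitLaws
  T3UnitLawDensityEML T4Continuum T3UnitScaleTilt T3LevelShift T3TiltDescent
open Summit.QuantumFields.YangMills.BalabanUVNodes.N09DomAltThresholdNull (isOpen_setOf_plaqSmall_SU)
open Literature.MathematicalPhysics.QuantumFieldTheory.Balaban1983to89.B12ContinuousTransportInvarianceOn (continuous_dist1_SU continuous_plaqHol_SU)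
open Summit.QuantumFields.YangMills.Theorems.FluctuationComparisonRegPrIntLRunpairOrganFibreLaw (mwCut wNum wgt)
open Summit.QuantumFields.YangMills.Theorems.OrganTangentFibreWeightNormalisation (wgt_normalised)

/-! ## §1 Abstract: bounded on the support of an integrable weight -/

section Abstract

variable {Z : Type*} [MeasurableSpace Z]

/-- A measurable function bounded by `M` on the support of an integrable measurable weight `w` has an integrable product with `w`. [folklore] -/
theorem integrable_mul_of_abs_le_on_support (τ : Measure Z) (g w : Z → ℝ) (hg : Measurable g) (hw : Measurable w)
    (hwi : Integrable w τ) (M : ℝ) (hM : ∀ z, w z ≠ 0 → |g z| ≤ M) :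
    Integrable (fun z => g z * w z) τ := by
  classical
  -- replace `g` by its truncation to the support of `w`
  set g' : Z → ℝ := fun z => if w z = 0 then 0 else g z with hg'
  have hg'm : Measurable g' := Measurable.ite (hw (measurableSet_singleton 0)) measurable_const hg
  have hg'b : ∀ z, |g' z| ≤ |M| := by
    intro z
    by_cases hz : w z = 0
    · simp only [hg', hz, if_true, abs_zero, abs_nonneg]
    · simp only [hg', hz, if_false]
      exact (hM z hz).trans (le_abs_self M)
  have heq : (fun z => g z * w z) = fun z => g' z * w z := by
    funext z
    by_cases hz : w z = 0
    · simp only [hg', hz, mul_zero]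
    · simp only [hg', hz, if_false]
  rw [heq]
  exact hwi.bdd_mul (c := |M|) hg'm.aestronglyMeasurable (Eventually.of_forall fun z => by rw [Real.norm_eq_abs]; exact hg'b z)

/-- Two measurable functions bounded on the support of an integrable measurable weight `w` have an integrable product with `w`. [folklore] -/
theorem integrable_mul_mul_of_abs_le_on_support (τ : Measure Z) (g₁ g₂ w : Z → ℝ) (hg₁ : Measurable g₁) (hg₂ : Measurable g₂)
    (hw : Measurable w) (hwi : Integrable w τ) (M₁ M₂ : ℝ) (hM₁ : ∀ z, w z ≠ 0 → |g₁ z| ≤ M₁) (hM₂ : ∀ z, w z ≠ 0 → |g₂ z| ≤ M₂) :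
    Integrable (fun z => g₁ z * g₂ z * w z) τ := by
  refine integrable_mul_of_abs_le_on_support τ (fun z => g₁ z * g₂ z) w (hg₁.mul hg₂) hw hwi (|M₁| * |M₂|) fun z hz => ?_
  rw [abs_mul]
  exact mul_le_mul ((hM₁ z hz).trans (le_abs_self _)) ((hM₂ z hz).trans (le_abs_self _)) (abs_nonneg _) (abs_nonneg _)

end Abstract

/-! ## §2 The organ's objects: `h_Ts` is bounded on a closed sub-window; square stability ⟹ square integrability -/

/-- On the closed `c·θ_Ts`-plaquette window (`c < 1`) the pinned functional `h_Ts = log ρ_Ts − log ρ′_Ts` is bounded, for densities continuous and positive on the open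
`θ_Ts`-window (compactness of the gauge-field space). [folklore] -/
theorem abs_logRatio_le_of_plaq_le (F : T3Family) (γ b₀ p₀ : ℝ) (Ts : ℕ)
    (ρ ρ' : GaugeField (F.P Ts) 0 ↥(Matrix.specialUnitaryGroup (Fin 2) ℂ) → ℝ)
    (hρc : ContinuousOn ρ {U | PlaqSmall (θBal F.L γ b₀ p₀ Ts) U}) (hρ'c : ContinuousOn ρ' {U | PlaqSmall (θBal F.L γ b₀ p₀ Ts) U})
    (hρpos : ∀ U, PlaqSmall (θBal F.L γ b₀ p₀ Ts) U → 0 < ρ U ∧ 0 < ρ' U)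
    (hθ : 0 < θBal F.L γ b₀ p₀ Ts) (c : ℝ) (hc : c < 1) :
    ∃ M : ℝ, ∀ U : GaugeField (F.P Ts) 0 ↥(Matrix.specialUnitaryGroup (Fin 2) ℂ),
      (∀ p, dist1 (GaugeField.plaqHol U p) ≤ c * θBal F.L γ b₀ p₀ Ts) → |Real.log (ρ U) - Real.log (ρ' U)| ≤ M := by
  haveI : CompactSpace (GaugeField (F.P Ts) 0 ↥(Matrix.specialUnitaryGroup (Fin 2) ℂ)) :=
    inferInstanceAs (CompactSpace (PBond (F.P Ts) 0 → ↥(Matrix.specialUnitaryGroup (Fin 2) ℂ)))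
  set C : Set (GaugeField (F.P Ts) 0 ↥(Matrix.specialUnitaryGroup (Fin 2) ℂ)) :=
    {U | ∀ p, dist1 (GaugeField.plaqHol U p) ≤ c * θBal F.L γ b₀ p₀ Ts} with hC
  have hCclosed : IsClosed C := by
    have : C = ⋂ p, {U | dist1 (GaugeField.plaqHol U p) ≤ c * θBal F.L γ b₀ p₀ Ts} := by
      ext U; simp only [hC, Set.mem_setOf_eq, Set.mem_iInter]
    rw [this]
    exact isClosed_iInter fun p => isClosed_le ((continuous_dist1_SU (N := 2)).comp (continuous_plaqHol_SU (N := 2) p)) continuous_const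
  have hCO : C ⊆ {U | PlaqSmall (θBal F.L γ b₀ p₀ Ts) U} := by
    intro U hU p
    have h1 : c * θBal F.L γ b₀ p₀ Ts < θBal F.L γ b₀ p₀ Ts := by nlinarith
    exact lt_of_le_of_lt (hU p) h1
  have hhc : ContinuousOn (fun U => Real.log (ρ U) - Real.log (ρ' U)) C :=
    ((hρc.log fun U hU => (hρpos U hU).1.ne').sub (hρ'c.log fun U hU => (hρpos U hU).2.ne')).mono hCO
  obtain ⟨M, hM⟩ := hCclosed.isCompact.exists_bound_of_continuousOn hhc
  exact ⟨M, fun U hU => by rw [← Real.norm_eq_abs]; exact hM U hU⟩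

/-- ★★ **SQUARE INTEGRABILITY ⟸ SQUARE STABILITY** — for the frame's densities, the multi-window cut and a fibred chart's data (as in ✓`wgt_normalised`), every real `t`, and
two coarse fields `X Xw` with `Xw` a window point: if every `z` in the support of `mwCut∘Φ(Xw,·)` has `Φ(X, z)` inside the closed `c·θ_Ts`-window (`c < 1`) — SQUARE
STABILITY, a HYPOTHESIS here — then `h_Ts∘Φ(X,·)` and its square are integrable against the interpolated law `wgt_t(Xw,·)` (the second half of `SpreadFibreLawHJ`'s
(JV0-h) at `(t, X, Xw)`). [folklore] -/
theorem integrable_logRatio_mul_wgt_of_squareStability (F : T3Family) (γ b₀ p₀ : ℝ) (j Ts : ℕ) (hjTs : j + 1 ≤ Ts)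
    (ρ ρ' : (i : ℕ) → GaugeField (F.P i) 0 ↥(Matrix.specialUnitaryGroup (Fin 2) ℂ) → ℝ)
    (hρm : Measurable (ρ Ts)) (hρ'm : Measurable (ρ' Ts))
    (hρc : ContinuousOn (ρ Ts) {U | PlaqSmall (θBal F.L γ b₀ p₀ Ts) U}) (hρ'c : ContinuousOn (ρ' Ts) {U | PlaqSmall (θBal F.L γ b₀ p₀ Ts) U})
    (hρpos : ∀ U, PlaqSmall (θBal F.L γ b₀ p₀ Ts) U → 0 < ρ Ts U ∧ 0 < ρ' Ts U)
    (hθ : 0 < θBal F.L γ b₀ p₀ Ts)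
    (hχc : Continuous (mwCut F γ b₀ p₀ j Ts)) (hχ0 : ∀ U, 0 ≤ mwCut F γ b₀ p₀ j Ts U)
    (hχsupp : ∀ U, mwCut F γ b₀ p₀ j Ts U ≠ 0 → ∀ (n : ℕ) (hjn : j + 1 ≤ n) (hnK : n ≤ Ts), PlaqSmall (24 / 25 * θBal F.L γ b₀ p₀ n) (descendTo F ℰp n Ts hnK U))
    (hχpos : ∀ U, (∀ (n : ℕ) (hjn : j + 1 ≤ n) (hnK : n ≤ Ts), PlaqSmall (24 / 25 * θBal F.L γ b₀ p₀ n) (descendTo F ℰp n Ts hnK U)) → 0 < mwCut F γ b₀ p₀ j Ts U)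
    {Z : Type} [MeasurableSpace Z] (τ : Measure Z) [IsProbabilityMeasure τ]
    (Φ : GaugeField (F.P j) 0 ↥(Matrix.specialUnitaryGroup (Fin 2) ℂ) × Z → GaugeField (F.P Ts) 0 ↥(Matrix.specialUnitaryGroup (Fin 2) ℂ))
    (J : GaugeField (F.P j) 0 ↥(Matrix.specialUnitaryGroup (Fin 2) ℂ) × Z → ℝ≥0)
    (hΦm : Measurable Φ) (hJm : Measurable J) (CJ : ℝ) (hJle : ∀ V z, (J (V, z) : ℝ) ≤ CJ)
    (hpos : ∀ V, PlaqSmall (θBal F.L γ b₀ p₀ j) V →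
      0 < ∫⁻ z in {z | (∀ (n : ℕ) (hjn : j + 1 ≤ n) (hnK : n ≤ Ts), PlaqSmall (24 / 25 * θBal F.L γ b₀ p₀ n) (descendTo F ℰp n Ts hnK (Φ (V, z))))},
        (J (V, z) : ℝ≥0∞) ∂τ)
    (c : ℝ) (hc : c < 1) (t : ℝ)
    (X Xw : GaugeField (F.P j) 0 ↥(Matrix.specialUnitaryGroup (Fin 2) ℂ)) (hXw : PlaqSmall (θBal F.L γ b₀ p₀ j) Xw)
    (hstab : ∀ z, mwCut F γ b₀ p₀ j Ts (Φ (Xw, z)) ≠ 0 → ∀ p, dist1 (GaugeField.plaqHol (Φ (X, z)) p) ≤ c * θBal F.L γ b₀ p₀ Ts) :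
    Integrable (fun z => (Real.log (ρ Ts (Φ (X, z))) - Real.log (ρ' Ts (Φ (X, z)))) * wgt F γ b₀ p₀ j Ts ρ ρ' τ Φ J t Xw z) τ ∧
    Integrable (fun z => (Real.log (ρ Ts (Φ (X, z))) - Real.log (ρ' Ts (Φ (X, z)))) ^ 2 * wgt F γ b₀ p₀ j Ts ρ ρ' τ Φ J t Xw z) τ := by
  haveI : BorelSpace (GaugeField (F.P Ts) 0 ↥(Matrix.specialUnitaryGroup (Fin 2) ℂ)) :=
    Literature.MathematicalPhysics.QuantumFieldTheory.Balaban1983to89.T3OrbitAverage.instBorelSpaceGaugeField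
  -- the law over `Xw` is integrable (✓`wgt_normalised`)
  obtain ⟨-, -, hwi, -⟩ := wgt_normalised F γ b₀ p₀ j Ts hjTs ρ ρ' hρm hρ'm hρc hρ'c hρpos hθ hχc hχ0 hχsupp hχpos τ Φ J hΦm hJm CJ hJle hpos t Xw hXw
  -- measurability of the weight and of the transported functional
  have hΦm1 : ∀ V, Measurable fun z => Φ (V, z) := fun V => hΦm.comp (measurable_const.prodMk measurable_id)
  have hJm1 : Measurable fun z => (J (Xw, z) : ℝ) := (hJm.comp (measurable_const.prodMk measurable_id)).coe_nnreal_real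
  have hNm : Measurable fun z => wNum F γ b₀ p₀ j Ts ρ ρ' Φ J t Xw z := by
    have h1 : Measurable fun z => mwCut F γ b₀ p₀ j Ts (Φ (Xw, z)) := hχc.measurable.comp (hΦm1 Xw)
    have h2 : Measurable fun z => Real.rpow (ρ Ts (Φ (Xw, z))) t * Real.rpow (ρ' Ts (Φ (Xw, z))) (1 - t) :=
      ((hρm.comp (hΦm1 Xw)).pow_const t).mul ((hρ'm.comp (hΦm1 Xw)).pow_const (1 - t))
    exact (h1.mul h2).mul hJm1
  have hWm : Measurable fun z => wgt F γ b₀ p₀ j Ts ρ ρ' τ Φ J t Xw z := hNm.div_const _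
  have hHm : Measurable fun z => Real.log (ρ Ts (Φ (X, z))) - Real.log (ρ' Ts (Φ (X, z))) :=
    (Real.measurable_log.comp (hρm.comp (hΦm1 X))).sub (Real.measurable_log.comp (hρ'm.comp (hΦm1 X)))
  -- `h_Ts` is bounded on the closed `c`-window, which carries `Φ(X,z)` on the support of the law over `Xw`
  obtain ⟨M, hM⟩ := abs_logRatio_le_of_plaq_le F γ b₀ p₀ Ts (ρ Ts) (ρ' Ts) hρc hρ'c hρpos hθ c hc
  have hsupp : ∀ z, wgt F γ b₀ p₀ j Ts ρ ρ' τ Φ J t Xw z ≠ 0 → mwCut F γ b₀ p₀ j Ts (Φ (Xw, z)) ≠ 0 := by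
    intro z hz hχz
    apply hz
    simp only [wgt, wNum, hχz, zero_mul, zero_div]
  have hbd : ∀ z, wgt F γ b₀ p₀ j Ts ρ ρ' τ Φ J t Xw z ≠ 0 → |Real.log (ρ Ts (Φ (X, z))) - Real.log (ρ' Ts (Φ (X, z)))| ≤ M :=
    fun z hz => hM _ (hstab z (hsupp z hz))
  refine ⟨integrable_mul_of_abs_le_on_support τ _ _ hHm hWm hwi M hbd, ?_⟩
  have e : (fun z => (Real.log (ρ Ts (Φ (X, z))) - Real.log (ρ' Ts (Φ (X, z)))) ^ 2 * wgt F γ b₀ p₀ j Ts ρ ρ' τ Φ J t Xw z)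
      = fun z => (Real.log (ρ Ts (Φ (X, z))) - Real.log (ρ' Ts (Φ (X, z)))) * (Real.log (ρ Ts (Φ (X, z))) - Real.log (ρ' Ts (Φ (X, z))))
          * wgt F γ b₀ p₀ j Ts ρ ρ' τ Φ J t Xw z := by
    funext z; ring
  rw [e]
  exact integrable_mul_mul_of_abs_le_on_support τ _ _ _ hHm hHm hWm hwi M M hbd hbd

end Summit.QuantumFields.YangMills.Theorems.OrganTangentFibreWeightSquareIntegrability

end
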